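import Summits.ResolutionOfSingularities.ResolutionOfSingularities.Theorems.HilbertSamuelEliminationSigmaMaxModificationsCorridor3SigmaMenuGateRowP
import HarnessLib

/-!
# [OURS · L1 W4.2] σ-LAYER — `Corridor3SigmaMenuGateTameLow`: THE TAME-LOW PRESCRIPTION OF RECORD `GroupGate.tameLowOfRecord pointPhase q2Face` — the instance
# of the `low` slot of `tamePrescriptionOfRecord` (p558772): «the LINEAGE POINT while base points remain or the traces are not snc (`pointPhase`), else a
# `Q₂`-allowed FACE of the `H₂` board (`q2Face`)», with its `𝓑`-permissibility transport and the gate-side reading of the lineage discipline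
# (cell res-hironaka, LADDER-RESOLUTION rung L; slot W4.2, crux chain w42 `SigmaMaxModifications` stmt-ResolutionOfSingularities-18506 / conjunct
# `SigmaMaxModificationsCorridor3` stmt-ResolutionOfSingularities-19249; res-L1-w42-plan-1 CHAIN v3.26 (0y.6) o1 row «tameLow := `TameLowPrescription` = lineage
# point while base points remain or snc fails, else the Q₂-face of the H₂ board», RULING v3.14-48 (PD)/(PF), -51 (51B) «T-L4/T-L7 typing»; typer res-L1-type-o1 g11
# TUO 20:42:35Z; `--supports stmt-…-19249 --as helper`, counted 0)

HONEST FRAMING. OURS design bookkeeping over this seat's gate files (`…MenuGateTameSplit` p556753/p557523: `PointReading`, `GroupGate.splitBy`, `tameByKind`;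
`…MenuGateTame` p552890: `le_menuCentre_closureSingleton_iff`, `isNormalCrossingWithBoundaryAt_point`; `…MenuGateTameHigh` p558772: `tamePrescriptionOfRecord`,
`CentreGate.ofRecordHigh`; `…MenuGateRowP` p566992: `CentreGate.ofRecordP`) and res-type-067's `menuCentre`. The two READINGS are PARAMETERS with named owners:
`pointPhase g` := «the coefficient ideal's residual `𝔞♮` at `g` still has base points (res-L1-type-o2 T-L2/T-L6 `CoeffDatum.basePointCount ≠ 0`, p558585/p561648) OR
the trace configuration `V(g_red) ∪ traces` is not snc at `g` (res-L1-w42-stub-4 T-L4 `¬ SncAt`, p565370/p567030)»; `q2Face g C` := «`V(C)` cuts a `Q₂`-ALLOWED member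
face of the `H₂` board at `g`» (res-L1-s42-pv-2 T-L5 `…Corridor3SigmaTameLowBoard` p556956 / res-D-pv-002 `QDiscipline.ofQ2Step`). NOTHING here is a statement of
H. Hironaka's manuscript [Hironaka2017] nor of Cossart–Jannsen–Saito; no named fact. AI-typed; AI review is weaker than expert review.

## Contents (namespace `…Theorems.SigmaMaxModificationsCorridor3.Sigma`)

* `pointCentreAt g := menuCentre ⟨closure {g}, _⟩` (the reduced point, the convention of `GroupGate.tame_point`), `coe_support_pointCentreAt` (closed `g`: `= {g}`),
  **`GroupGate.pointStep`** (`C = pointCentreAt g` — «the LINEAGE POINT»), `pointStep_iff`.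
* **`GroupGate.tameLowOfRecord pointPhase q2Face := splitBy pointPhase pointStep q2Face`**; unfoldings `tameLowOfRecord_of_pointPhase` / `_of_not_pointPhase`.
* `𝓑`-PERMISSIBILITY: **`isBPermissible_pointCentreAt`** (a PERMISSIBLE reduced CLOSED point with regular reduced structure is `𝓑`-permissible for EVERY boundary —
  every member through `g` contains `{g}`; CJS Def. 5.2), **`tameLowOfRecord_isBPermissible`** (the `hl` binder of `tameByKind_isBPermissible` /
  `tamePrescriptionP_isBPermissible`, from «point centres at point-phase points are `𝓑`-permissible» + «`q2Face` carries `𝓑`-permissibility»).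
* GATE-SIDE LINEAGE DISCIPLINE (the gate half of o2's reading axioms `IsPointChild`/`IsSncChild`/`IsEndChild`): with `low := tameLowOfRecord pointPhase q2Face` in
  the gate of record — **`CentreGate.ofRecordHigh_tameLow_point`** (at a TAME-LOW point in point phase on `V(C)`, a passing centre IS the point `g`),
  **`CentreGate.ofRecordHigh_tameLow_face`** (in end-game it is a `Q₂`-face at `g`), and the same two through the P-MODE gate in MENU rows
  (`CentreGate.ofRecordP_tameLow_point` / `_face`).

VACUITY SELF-CHECK. `tameLowOfRecord` is exactly as contentful as its readings: in point phase it admits ONE centre (the point), in end-game whatever `q2Face`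
admits; it is the honest gate form of RULING -48 (PD)'s three phases (base points → snc → end-game), the first two sharing the centre rule. Not vacuous: a curve
through a point-phase TAME-LOW point is refused.
-/

noncomputable section

set_option linter.dupNamespace false -- mandated namespace of this single-conjunct summit

open CategoryTheory AlgebraicGeometry TopologicalSpace
open Summit.ResolutionOfSingularities.ResolutionOfSingularities.Theorems.CampaignW42
open Literature.AlgebraicGeometry.Resolution Literature.RingTheory.HilbertSamuel

namespace Summit.ResolutionOfSingularities.ResolutionOfSingularities.Theorems.SigmaMaxModificationsCorridor3.Sigma

universe u

variable {W : Scheme.{u}}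

/-! ## The lineage point as a centre -/

/-- [OURS · L1 W4.2] **THE REDUCED POINT CENTRE AT `g`** — `menuCentre ⟨closure {g}, _⟩` (res-type-067's reduced structure on the closed set; for a closed point the
reduced point `𝓘({g})`; the convention of `GroupGate.tame_point`). NOT a statement of the manuscript. [folklore] -/
abbrev pointCentreAt (g : W) : W.IdealSheafData :=
  menuCentre ⟨closure {g}, isClosed_closure⟩

/-- For a closed point the support of the point centre is `{g}`. [folklore] -/
theorem coe_support_pointCentreAt {g : W} (hg : IsClosed ({g} : Set W)) : ((pointCentreAt g).support : Set W) = {g} := by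
  rw [pointCentreAt, coe_support_menuCentre]
  exact hg.closure_eq

/-- A member contains the point centre iff the point lies on it. [folklore] -/
theorem le_pointCentreAt_iff (B : W.IdealSheafData) (g : W) : B ≤ pointCentreAt g ↔ g ∈ (B.support : Set W) :=
  le_menuCentre_closureSingleton_iff B g

/-- [OURS · L1 W4.2] **THE POINT STEP AS A GROUP GATE** («blow up the LINEAGE POINT»): at `g` the only admitted centre is the reduced point `pointCentreAt g`.
NOT a statement of the manuscript. [folklore] -/
def GroupGate.pointStep : GroupGate.{u} :=
  fun _ _ _ _ _ _ _ g C => C = pointCentreAt g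

variable {N : ℕ} {ν : ℕ → ℕ} {hW : IsLocallyNoetherian W} {L : Labelling W} {P : Option (Pending W)} {E : Boundary W} {g : W} {C : W.IdealSheafData}

/-- Unfolding (`Iff.rfl`). [folklore] -/
theorem GroupGate.pointStep_iff : GroupGate.pointStep W hW N ν L P E g C ↔ C = pointCentreAt g :=
  Iff.rfl

/-! ## The TAME-LOW prescription of record -/

/-- [OURS · L1 W4.2] **THE TAME-LOW PRESCRIPTION OF RECORD** (RULING v3.14-48 (PD): base-point phase → snc phase → end-game; CHAIN v3.26 «lineage point while base
points remain or snc fails, else the Q₂-face of the H₂ board»): at a TAME-LOW point `g` — in POINT PHASE (`pointPhase g`: the residual coefficient ideal `𝔞♮`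
still has base points, or the trace configuration is not yet snc at `g`) the centre is THE POINT `g`; otherwise (END-GAME) the centre is a `Q₂`-allowed face of
the `H₂` board at `g` (`q2Face`). `= splitBy pointPhase pointStep q2Face`. The instance of the `low` slot of `tamePrescriptionOfRecord`. NOT a statement of the
manuscript. [folklore] -/
def GroupGate.tameLowOfRecord (pointPhase : PointReading.{u}) (q2Face : GroupGate.{u}) : GroupGate.{u} :=
  GroupGate.splitBy pointPhase GroupGate.pointStep q2Face

section TameLow

variable {pointPhase : PointReading.{u}} {q2Face : GroupGate.{u}}

/-- In point phase the prescription admits exactly the point. [folklore] -/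
theorem GroupGate.tameLowOfRecord_of_pointPhase (h : pointPhase W hW N ν L P E g) :
    GroupGate.tameLowOfRecord pointPhase q2Face W hW N ν L P E g C ↔ C = pointCentreAt g := by
  rw [GroupGate.tameLowOfRecord, GroupGate.splitBy_of_pos h, GroupGate.pointStep_iff]

/-- In end-game the prescription is the `Q₂`-face reading. [folklore] -/
theorem GroupGate.tameLowOfRecord_of_not_pointPhase (h : ¬ pointPhase W hW N ν L P E g) :
    GroupGate.tameLowOfRecord pointPhase q2Face W hW N ν L P E g C ↔ q2Face W hW N ν L P E g C := by
  rw [GroupGate.tameLowOfRecord, GroupGate.splitBy_of_neg h]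

/-! ## `𝓑`-permissibility -/

/-- **A PERMISSIBLE REDUCED CLOSED POINT IS `𝓑`-PERMISSIBLE FOR EVERY BOUNDARY**: every member through `g` contains `{g}` (no transversality to check), so CJS's
normal-crossing condition at the unique point `g` of the centre reduces to the regularity of the reduced point (`isNormalCrossingWithBoundaryAt_point`).
[cite: CossartJannsenSaito2020, Def. 5.2, Def. 5.4 (LNM 2270, pp. 67–68)] -/
theorem isBPermissible_pointCentreAt (E : Boundary W) (hg : IsClosed ({g} : Set W)) (hperm : IdealSheafData.IsPermissible (pointCentreAt g))
    (hreg : IsRegularLocalRing ((W.presheaf.stalk g) ⧸ stalkIdeal (pointCentreAt g) g)) : IsBPermissible (pointCentreAt g) E := by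
  refine ⟨hperm, fun x hx => ?_⟩
  rw [coe_support_pointCentreAt hg, Set.mem_singleton_iff] at hx
  subst hx
  exact isNormalCrossingWithBoundaryAt_point E hreg

/-- **THE TAME-LOW PRESCRIPTION CARRIES `𝓑`-PERMISSIBILITY** — the `hl` binder of `tameByKind_isBPermissible` / `tamePrescriptionP_isBPermissible` — from two
reading obligations: point centres at point-phase points are `𝓑`-permissible for the current boundary (`isBPermissible_pointCentreAt`: closed, permissible, reduced
point regular — res-type-067's `isMenuCentreAt_point` data), and `q2Face` carries `𝓑`-permissibility (T-L5's faces are snc with the board members).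
[cite: CossartJannsenSaito2020, Def. 5.4] -/
theorem GroupGate.tameLowOfRecord_isBPermissible
    (hpt : ∀ (W : Scheme.{u}) hW N ν L P (E : Boundary W) (g : W), pointPhase W hW N ν L P E g → IsBPermissible (pointCentreAt g) E)
    (hq : ∀ (W : Scheme.{u}) hW N ν L P (E : Boundary W) (g : W) (C : W.IdealSheafData), q2Face W hW N ν L P E g C → IsBPermissible C E) :
    ∀ (W : Scheme.{u}) hW N ν L P (E : Boundary W) (g : W) (C : W.IdealSheafData),
      GroupGate.tameLowOfRecord pointPhase q2Face W hW N ν L P E g C → IsBPermissible C E :=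
  fun W hW N ν L P E g C h => by
    by_cases hp : pointPhase W hW N ν L P E g
    · rw [GroupGate.tameLowOfRecord_of_pointPhase hp] at h
      subst h
      exact hpt W hW N ν L P E g hp
    · rw [GroupGate.tameLowOfRecord_of_not_pointPhase hp] at h
      exact hq W hW N ν L P E g C h

end TameLow

/-! ## The gate of record with the TAME-LOW instance: the lineage discipline, gate side -/

section Record

variable {corners tamePts : CornerReading.{u}} {face γe γeS midWild surface q2Face : GroupGate.{u}} {kind : CornerKindReading.{u}} {tk : TameKindReading.{u}}
  {sncSurface pointPhase : PointReading.{u}} {germ : TameGermReading.{u}} {sval : RowValueReading.{u}} {mode : RowModeReading.{u}} {rowP : ℕ → GroupGate.{u}}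

/-- **IN POINT PHASE THE ONLY CENTRE THROUGH A TAME-LOW POINT IS THE POINT** (gate of record p558772 with `low := tameLowOfRecord pointPhase q2Face`): the
gate side of o2's `IsPointChild` / `IsSncChild` — a Q2 curve, a contact curve or a surface through `g` is refused while `g` is in point phase. [folklore] -/
theorem CentreGate.ofRecordHigh_tameLow_point
    (h : CentreGate.ofRecordHigh corners face kind γe tamePts tk sncSurface germ γeS (GroupGate.tameLowOfRecord pointPhase q2Face) midWild surface
      W hW N ν L P E C)
    (hg : g ∈ tamePts W hW N ν L P E) (hgC : g ∈ (C.support : Set W)) (hk : tk W hW N ν L P E g = .low) (hph : pointPhase W hW N ν L P E g) :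
    C = pointCentreAt g :=
  (GroupGate.tameLowOfRecord_of_pointPhase hph).mp (CentreGate.ofRecordSplit_tameLow (by rwa [CentreGate.ofRecordHigh_eq] at h) hg hgC hk)

/-- **IN END-GAME THE CENTRE THROUGH A TAME-LOW POINT IS A `Q₂`-FACE** (the gate side of o2's `IsEndChild`). [folklore] -/
theorem CentreGate.ofRecordHigh_tameLow_face
    (h : CentreGate.ofRecordHigh corners face kind γe tamePts tk sncSurface germ γeS (GroupGate.tameLowOfRecord pointPhase q2Face) midWild surface
      W hW N ν L P E C)
    (hg : g ∈ tamePts W hW N ν L P E) (hgC : g ∈ (C.support : Set W)) (hk : tk W hW N ν L P E g = .low) (hph : ¬ pointPhase W hW N ν L P E g) :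
    q2Face W hW N ν L P E g C :=
  (GroupGate.tameLowOfRecord_of_not_pointPhase hph).mp (CentreGate.ofRecordSplit_tameLow (by rwa [CentreGate.ofRecordHigh_eq] at h) hg hgC hk)

/-- The same through the P-MODE gate (p566992) in a MENU row: point phase ⇒ the point. [folklore] -/
theorem CentreGate.ofRecordP_tameLow_point
    (h : CentreGate.ofRecordP corners face kind γe tamePts sval mode tk sncSurface germ γeS (GroupGate.tameLowOfRecord pointPhase q2Face) midWild surface rowP
      W hW N ν L P E C)
    (hg : g ∈ tamePts W hW N ν L P E) (hgC : g ∈ (C.support : Set W)) (hm : mode W hW N ν L P E (sval W hW N ν L P E g) = .menu)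
    (hk : tk W hW N ν L P E g = .low) (hph : pointPhase W hW N ν L P E g) : C = pointCentreAt g := by
  have h1 := (GroupGate.tamePrescriptionP_of_menu hm).mp (h.2 g hg hgC)
  rw [GroupGate.tamePrescriptionOfRecord_eq, GroupGate.tameByKind_of_low hk] at h1
  exact (GroupGate.tameLowOfRecord_of_pointPhase hph).mp h1

/-- The same through the P-MODE gate in a MENU row: end-game ⇒ a `Q₂`-face. [folklore] -/
theorem CentreGate.ofRecordP_tameLow_face
    (h : CentreGate.ofRecordP corners face kind γe tamePts sval mode tk sncSurface germ γeS (GroupGate.tameLowOfRecord pointPhase q2Face) midWild surface rowP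
      W hW N ν L P E C)
    (hg : g ∈ tamePts W hW N ν L P E) (hgC : g ∈ (C.support : Set W)) (hm : mode W hW N ν L P E (sval W hW N ν L P E g) = .menu)
    (hk : tk W hW N ν L P E g = .low) (hph : ¬ pointPhase W hW N ν L P E g) : q2Face W hW N ν L P E g C := by
  have h1 := (GroupGate.tamePrescriptionP_of_menu hm).mp (h.2 g hg hgC)
  rw [GroupGate.tamePrescriptionOfRecord_eq, GroupGate.tameByKind_of_low hk] at h1
  exact (GroupGate.tameLowOfRecord_of_not_pointPhase hph).mp h1

end Record

end Summit.ResolutionOfSingularities.ResolutionOfSingularities.Theorems.SigmaMaxModificationsCorridor3.Sigma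

end
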